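import Summits.HodgeConjecture.CorCM.Census.CentralSquaresFibreCongruences
import Summits.HodgeConjecture.CorCM.Census.CentralSquaresOrderFourLaw
import Summits.HodgeConjecture.CorCM.Census.CentralSquaresOrbitFrameLaw

/-!
# The square-central class, XLIV: THE MIXED-FACE FRAME LAW `μ(G, c) = φ₂(G, c)` at every `m ≥ 2`

COR-CM (cell `pub-hodgecm2`), count-neutral kernel combinatorics by the binder seat b09 (gen 48; lane SQUARE-CENTRAL CLASS, part XLIV), assembling parts XIII/XXIX
(`isLeast_card_gfaces_generate_of_chosen_cover_closure`, `exists_admissible_choice₃`), XXXVIII (`ddist_orbit_type`, `not_strict_rt_orbit_type`), XLIII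
(`strict_triple_orbit_corner`, `fibre_congruences`), XXXI (`strict_triple_rt`), XXV (`rel_transversal_mem'`, `relc_mem'`), XLII (`residual_closure_cyclic`)
and V/VII (frame exchange, companion frame) BY NAME.  Theorems only: no definition, no `decide`, no certificate, no named fact, no `sorry`.  HONEST FRAMING:
`HC_CM` is NOT proved, here or anywhere in the tree; nothing here is a period or a headline.

**`isLeast_card_gfaces_generate_mixed`** — THE MIXED-FACE FRAME LAW (part XXXIʼs order-`4` frame law at EVERY `m ≥ 2`, with kernel movers in place of the
`m = 2` place relations).  `G` a `2`-group, `c` a central involution `≠ 1`; the four-type frame `(T₀; T₁)` with `|T₀| = 4m`, `|𝓗| = 2m`, `2m = 2ᵏ`; a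
base-involutive swap `Q` (`T₀·Q⁻¹ = T₁`, `T₁·Q⁻¹ = T₀`, place permutation preserving `𝓗`); transversals `T ⊆ 𝓗`, `A ⊆ 𝓗ᶜ` of size `m`; the designated
type `Φ = {T ∣ A}` with its MIXED face at `a ∈ A`, `h ∈ 𝓗 ∖ T`; a second place `h₂ ∈ 𝓗 ∖ T` and a place `κ₂ ∈ 𝓗ᶜ ∖ A` (`≠ h·g₁⁻¹`) for the two
prescribed tie faces; `g₁` stabilising `T₀` and `Φ` with `T₁·g₁⁻¹ = T̄₁`; KERNEL MOVERS: every `x ∈ 𝓗 ∖ T` is `h·u⁻¹` and every `y ∈ 𝓗ᶜ ∖ A` is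
`h·g₁⁻¹·u⁻¹` for some `u ∈ Stab T₀ ∩ Stab T₁ ∩ Stab Φ`; and the two tie blocks are distinct (`Φ^{(a)}·g⁻¹ ≠ Φ^{(h)}`).  Then **`μ(G, c) = φ₂(G, c)`**:
prescribe the mixed face at the block of `Φ` (no strict triple there: a four-way tie, part XXXVIII) and the strict triples toward `T₁` at `Φ^{(a)}` (places
`c·h, c·h₂`, an orbit corner of the exchanged frame) and toward `T̄₀` at `Φ^{(h)}` (places `h·g₁⁻¹, κ₂`; its complement is an orbit corner of the companion
frame) — part XXIX; every strict cover containing them yields the fibre congruences (part XLIII), hence the residual closure up to `2m = 2ᵏ` (parts XXV,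
XLII); part XIII concludes.  In the rows (part XLV): EVERY dihedral quotient `π : G ↠ D₄` of a finite `2`-group with `π c = r²` and `|ker π| ≥ 2`.

## References
* [Pohlmann1968] H. Pohlmann, Algebraic cycles on abelian varieties of complex multiplication type, Ann. of Math. 88 (1968), Thm 1.
* [Milne1999] J. S. Milne, Lefschetz motives and the Tate conjecture, Compositio Math. 117 (1999), Prop. 2.1, p. 54.
-/

namespace Summit.HodgeConjecture.CorCM.Census.CentralSquares

open Finset
open scoped symmDiff
open Summit.HodgeConjecture.CorCM.Prior.AllgGroup.RfwfAllgGroup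
open Summit.HodgeConjecture.CorCM.Census.BlockParity
open Summit.HodgeConjecture.CorCM.Census.Coinvariant
open Summit.HodgeConjecture.CorCM.Census.TwistGeneration
open Summit.HodgeConjecture.CorCM.Census.BaseBlock
open Summit.HodgeConjecture.CorCM.Census.CoverClosure

noncomputable section

variable {G : Type*} [Group G] [Fintype G] [DecidableEq G] (c : G)

section Frame

variable (hc2 : c * c = 1) (hcen : ∀ x : G, x * c = c * x) (T₀ T₁ : CMF G c)
variable (hbase : ∀ Q : G, rt c Q T₀ = T₀ ∨ rt c Q T₀ = rt c c T₀ ∨ rt c Q T₀ = T₁ ∨ rt c Q T₀ = rt c c T₁)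
variable (m : ℕ) (hn : T₀.1.card = 4 * m) (hH : (T₀.1 \ T₁.1).card = 2 * m)

include hcen hbase hn hH in
/-- **THE MIXED-FACE FRAME LAW `μ(G, c) = φ₂(G, c)`** (see the file header for the hypotheses). [folklore] -/
theorem isLeast_card_gfaces_generate_mixed (hG : IsPGroup 2 G) (hc1 : c ≠ 1) (hm : 2 ≤ m) (k : ℕ) (hkm : (2 : ℤ) ^ k = 2 * (m : ℤ))
    (Q : G) (hQ : rt c Q T₀ = T₁) (hQ₁ : rt c Q T₁ = T₀)
    (hσH : ∀ t ∈ T₀.1, ∀ t' ∈ T₀.1, (t' = t * Q ∨ t' = c * (t * Q)) → (t ∈ T₀.1 \ T₁.1 ↔ t' ∈ T₀.1 \ T₁.1))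
    (T A : Finset G) (hTH : T ⊆ T₀.1 \ T₁.1) (hTm : T.card = m) (hA : A ⊆ T₀.1 ∩ T₁.1) (hAm : A.card = m)
    (hT : ∀ t ∈ T₀.1 \ T₁.1, ∀ t' ∈ T₀.1, (t' = t * Q ∨ t' = c * (t * Q)) → (t ∈ T ↔ t' ∉ T))
    (hAtr : ∀ t ∈ T₀.1 ∩ T₁.1, ∀ t' ∈ T₀.1, (t' = t * Q ∨ t' = c * (t * Q)) → (t ∈ A ↔ t' ∉ A))
    (Φ : CMF G c) (hΦ : T₀.1 \ Φ.1 = T ∪ A)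
    {a h : G} (ha : a ∈ A) (hh : h ∈ (T₀.1 \ T₁.1) \ T) {h₂ : G} (hh₂ : h₂ ∈ (T₀.1 \ T₁.1) \ T) (hhh₂ : h ≠ h₂)
    (g₁ : G) (hg₀ : rt c g₁ T₀ = T₀) (hg₁ : rt c g₁ T₁ = rt c c T₁) (hgΦ : rt c g₁ Φ = Φ)
    {κ₂ : G} (hκ₂ : κ₂ ∈ (T₀.1 ∩ T₁.1) \ A) (hκ₁₂ : h * g₁⁻¹ ≠ κ₂)
    (hTex : ∀ x ∈ (T₀.1 \ T₁.1) \ T, ∃ u : G, rt c u T₀ = T₀ ∧ rt c u T₁ = T₁ ∧ rt c u Φ = Φ ∧ x = h * u⁻¹)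
    (hAex : ∀ y ∈ (T₀.1 ∩ T₁.1) \ A, ∃ u : G, rt c u T₀ = T₀ ∧ rt c u T₁ = T₁ ∧ rt c u Φ = Φ ∧ y = h * g₁⁻¹ * u⁻¹)
    (hB : ∀ g : G, rt c g (oflipCM c hc2 a Φ) ≠ oflipCM c hc2 h Φ) :
    IsLeast {n : ℕ | ∃ S : Finset (CMF G c →₀ ℤ), (↑S ⊆ gfaceSet G c hc2) ∧ S.card = n ∧
      hodgeSpan c hc2 ≤ Submodule.span ℤ (pairSet c) ⊔ Submodule.span ℤ (translates c S)} (fibreTwo c hc2) := by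
  have hm1 : 1 ≤ m := by omega
  have hcinv : c⁻¹ = c := inv_eq_of_mul_eq_one_right hc2
  -- the elements
  have ha0 : a ∈ T₀.1 := (mem_inter.mp (hA ha)).1
  have ha1 : a ∈ T₁.1 := (mem_inter.mp (hA ha)).2
  have haΦ : a ∉ Φ.1 := by
    have h0 : a ∈ T₀.1 \ Φ.1 := by rw [hΦ]; exact mem_union_right _ ha
    exact (mem_sdiff.mp h0).2
  have hh0 : h ∈ T₀.1 := (mem_sdiff.mp (mem_sdiff.mp hh).1).1
  have hh1 : h ∉ T₁.1 := (mem_sdiff.mp (mem_sdiff.mp hh).1).2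
  have hh₂0 : h₂ ∈ T₀.1 := (mem_sdiff.mp (mem_sdiff.mp hh₂).1).1
  have hch1 : c * h ∈ T₁.1 := by by_contra hc'; exact hh1 ((T₁.2 h).mpr hc')
  have hch0 : c * h ∉ T₀.1 := (T₀.2 h).mp hh0
  have hhΦ : h ∈ Φ.1 := by
    by_contra hc'
    have h0 : h ∈ T₀.1 \ Φ.1 := mem_sdiff.mpr ⟨hh0, hc'⟩
    rw [hΦ, mem_union] at h0
    rcases h0 with hT' | hAm'
    · exact (mem_sdiff.mp hh).2 hT'
    · exact hh1 (mem_inter.mp (hA hAm')).2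
  have hchΦ : c * h ∉ Φ.1 := (Φ.2 h).mp hhΦ
  have hach : a ≠ c * h := fun e => hch0 (e ▸ ha0)
  have hchch₂ : c * h ≠ c * h₂ := fun e => hhh₂ (mul_left_cancel e)
  have hκ₁0 : h * g₁⁻¹ ∈ T₀.1 := by
    have e : h * g₁⁻¹ ∈ (rt c g₁ T₀).1 := by rw [mem_rt, inv_mul_cancel_right]; exact hh0
    rwa [hg₀] at e
  have hκ₁Φ : h * g₁⁻¹ ∈ Φ.1 := by
    have e : h * g₁⁻¹ ∈ (rt c g₁ Φ).1 := by rw [mem_rt, inv_mul_cancel_right]; exact hhΦ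
    rwa [hgΦ] at e
  have hκ₁1 : h * g₁⁻¹ ∈ T₁.1 := by
    by_contra hc'
    have e : h * g₁⁻¹ ∈ (rt c c T₁).1 := (mem_compl_type_iff c hcen T₁ _).mpr hc'
    rw [← hg₁, mem_rt, inv_mul_cancel_right] at e
    exact hh1 e
  have hκ₁ : h * g₁⁻¹ ∈ (T₀.1 ∩ T₁.1) \ A := by
    refine mem_sdiff.mpr ⟨mem_inter.mpr ⟨hκ₁0, hκ₁1⟩, fun hκA => ?_⟩
    have e : h * g₁⁻¹ ∈ T₀.1 \ Φ.1 := by rw [hΦ]; exact mem_union_right _ hκA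
    exact (mem_sdiff.mp e).2 hκ₁Φ
  have hκ₂0 : κ₂ ∈ T₀.1 := (mem_inter.mp (mem_sdiff.mp hκ₂).1).1
  have hHc : (T₀.1 ∩ T₁.1).card = 2 * m := by
    have h0 := card_sdiff_add_card_inter T₀.1 T₁.1; rw [hn, hH] at h0; omega
  have hA' : A ⊆ T₀.1 \ (T₀.1 \ T₁.1) := by
    intro x hx
    obtain ⟨hx0, hx1⟩ := mem_inter.mp (hA hx)
    exact mem_sdiff.mpr ⟨hx0, fun h' => (mem_sdiff.mp h').2 hx1⟩
  -- the exchanged frame `(T₁; T₀)`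
  have hbase₁ := base_cases_exchange c hbase hQ
  have hn₁ : T₁.1.card = 4 * m := card_frame c hc2 T₀ T₁ m hn
  have hH₁ : (T₁.1 \ T₀.1).card = 2 * m := by rw [card_sdiff_frame c hc2 T₀ T₁, hH]
  have hbf : ∀ Ψ : CMF G c, bpot c T₁ Ψ = bpot c T₀ Ψ := fun Ψ => by rw [← hQ]; exact bpot_frame c T₀ Q Ψ
  have hQinv : rt c Q⁻¹ T₀ = T₁ := by
    have e := rt_inv_rt c Q T₁; rwa [hQ₁] at e
  -- `T' = c·(𝓗 ∖ T)`, `B' = A ∖ a`; `D_{T₁}(Φ^{(a)}) = T' ∪ B'`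
  set T' := ((T₀.1 \ T₁.1) \ T).image (fun x => c * x) with hT'def
  have hT'H : T' ⊆ T₁.1 \ T₀.1 := by
    intro x hx
    obtain ⟨u, hu, rfl⟩ := mem_image.mp hx
    obtain ⟨hu0, hu1⟩ := mem_sdiff.mp (mem_sdiff.mp hu).1
    exact mem_sdiff.mpr ⟨by by_contra h'; exact hu1 ((T₁.2 u).mpr h'), (T₀.2 u).mp hu0⟩
  have hT'm : T'.card = m := by
    rw [hT'def, card_image_of_injective _ (mul_right_injective c), card_sdiff_of_subset hTH, hH, hTm]; omega
  have hB' : A.erase a ⊆ T₁.1 \ (T₁.1 \ T₀.1) := by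
    intro b hb
    have hbA := mem_of_mem_erase hb
    exact mem_sdiff.mpr ⟨(mem_inter.mp (hA hbA)).2, fun h' => (mem_sdiff.mp h').2 (mem_inter.mp (hA hbA)).1⟩
  have hB'm : (A.erase a).card < m := by rw [card_erase_of_mem ha, hAm]; omega
  have haT' : a ∉ T' := fun h' => (mem_sdiff.mp (hT'H h')).2 ha0
  have hD1 : T₁.1 \ Φ.1 = A ∪ T' := sdiff_T₁_pair_type c hc2 T₀ T₁ T A hTH hA Φ hΦ
  have hXa : T₁.1 \ (oflipCM c hc2 a Φ).1 = T' ∪ A.erase a := by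
    rw [dev_oflip c hc2 ha1 haΦ, hD1, erase_union_distrib, erase_eq_of_notMem haT', union_comm]
  have hchT' : c * h ∈ T' := mem_image.mpr ⟨h, hh, rfl⟩
  have hch₂T' : c * h₂ ∈ T' := mem_image.mpr ⟨h₂, hh₂, rfl⟩
  -- (B₀) the designated block: a four-way tie, no strict triple; the mixed face lowers toward `T₁`
  obtain ⟨hb, hall⟩ := ddist_orbit_type c hc2 hcen T₀ T₁ hbase m hn hH T A hTH hTm hA' hAm Φ hΦ
  have hd1 : ddist T₁ Φ = 2 * m := by have e := hall Q; rwa [hQ] at e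
  obtain ⟨g, hg⟩ : ∃ g : G, rt c g Φ = (blk c Φ).out := exists_rt_eq_of_blk_eq c (blk_out c (blk c Φ)).symm
  have hlow₀ : bpot c T₀ (blk c Φ).out = ddist (rt c (g * Q) T₀) (blk c Φ).out ∧
      a * g⁻¹ ∈ (rt c (g * Q) T₀).1 \ ((blk c Φ).out).1 ∧ (c * h) * g⁻¹ ∈ (rt c (g * Q) T₀).1 \ ((blk c Φ).out).1 ∧
      a * g⁻¹ ≠ (c * h) * g⁻¹ := by
    rw [← hg, bpot_rt, rt_mul, hQ, ddist_rt, hb, hd1, mem_sdiff_rt_iff, mem_sdiff_rt_iff, inv_mul_cancel_right, inv_mul_cancel_right]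
    exact ⟨rfl, mem_sdiff.mpr ⟨ha1, haΦ⟩, mem_sdiff.mpr ⟨hch1, hchΦ⟩, fun e => hach (mul_right_cancel e)⟩
  have h₀ns := not_strict_rt_orbit_type c hc2 hcen T₀ T₁ hbase m hn hH hm1 T A hTH hTm hA' hAm Φ hΦ hQ g
  rw [hg] at h₀ns
  -- (B₁) the block of `Φ^{(a)}`: the strict triple toward `T₁` with places `c·h, c·h₂` (orbit corner of the exchanged frame)
  have hS₁' := strict_triple_orbit_corner c hc2 hcen T₁ T₀ hbase₁ m hn₁ hH₁ T' (A.erase a) hT'H hT'm hB' hB'm (oflipCM c hc2 a Φ) hXa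
    hchT' hch₂T' hchch₂
  have hS₁ : bpot c T₀ (oflipCM c hc2 a Φ) = ddist (rt c Q⁻¹ T₀) (oflipCM c hc2 a Φ) ∧
      c * h ∈ (rt c Q⁻¹ T₀).1 \ (oflipCM c hc2 a Φ).1 ∧ c * h₂ ∈ (rt c Q⁻¹ T₀).1 \ (oflipCM c hc2 a Φ).1 ∧ c * h ≠ c * h₂ ∧
      (∀ Q' : G, ddist (rt c Q' T₀) (oflipCM c hc2 (c * h) (oflipCM c hc2 a Φ)) = bpot c T₀ (oflipCM c hc2 (c * h) (oflipCM c hc2 a Φ)) →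
        rt c Q' T₀ = rt c Q⁻¹ T₀) ∧
      (∀ Q' : G, ddist (rt c Q' T₀) (oflipCM c hc2 (c * h₂) (oflipCM c hc2 a Φ)) = bpot c T₀ (oflipCM c hc2 (c * h₂) (oflipCM c hc2 a Φ)) →
        rt c Q' T₀ = rt c Q⁻¹ T₀) ∧
      (∀ Q' : G, ddist (rt c Q' T₀) (oflipCM c hc2 (c * h) (oflipCM c hc2 (c * h₂) (oflipCM c hc2 a Φ))) =
          bpot c T₀ (oflipCM c hc2 (c * h) (oflipCM c hc2 (c * h₂) (oflipCM c hc2 a Φ))) → rt c Q' T₀ = rt c Q⁻¹ T₀) := by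
    obtain ⟨e1, hs, hs', hss', hu1, hu2, hu3⟩ := hS₁'
    rw [rt_one] at e1 hs hs'
    have htr : ∀ Y : CMF G c, (∀ Q' : G, ddist (rt c Q' T₁) Y = bpot c T₁ Y → rt c Q' T₁ = rt c 1 T₁) →
        ∀ Q' : G, ddist (rt c Q' T₀) Y = bpot c T₀ Y → rt c Q' T₀ = rt c Q⁻¹ T₀ := by
      intro Y hY
      have e := unique_frame c T₁ Q hY
      rw [hQ₁, one_mul] at e
      exact e
    refine ⟨?_, ?_, ?_, hss', htr _ hu1, htr _ hu2, htr _ hu3⟩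
    · rw [hQinv, ← hbf]; exact e1
    · rw [hQinv]; exact hs
    · rw [hQinv]; exact hs'
  have hbpa : bpot c T₀ (oflipCM c hc2 a Φ) = 2 * m - 1 := by
    have e := (bpot_orbit_corner c hc2 hcen T₁ T₀ hbase₁ m hn₁ hH₁ T' (A.erase a) hT'H hT'm hB' hB'm (oflipCM c hc2 a Φ) hXa).1
    rw [hbf, card_erase_of_mem ha, hAm] at e
    rw [e]; omega
  obtain ⟨g', hg'⟩ : ∃ g' : G, rt c g' (oflipCM c hc2 a Φ) = (blk c (oflipCM c hc2 a Φ)).out :=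
    exists_rt_eq_of_blk_eq c (blk_out c (blk c (oflipCM c hc2 a Φ))).symm
  have hτ₁ := strict_triple_rt c hc2 T₀ g' hS₁
  rw [hg'] at hτ₁
  -- (B₂) the block of `Φ^{(h)}`: the strict triple toward `T̄₀` with places `h·g₁⁻¹, κ₂`, through the complement (orbit corner of the companion frame)
  have hbase₂ := companion_base c hc2 T₀ T₁ hbase
  have hH₂ : (T₀.1 \ (rt c c T₁).1).card = 2 * m := companion_card c hcen T₀ T₁ m hn hH
  set T'' := (T₀.1 ∩ T₁.1) \ A with hT''def
  set B'' := ((T₀.1 \ T₁.1) \ T).erase h with hB''def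
  have hI : T₀.1 ∩ T₁.1 = T₀.1 \ (rt c c T₁).1 := by
    ext x; simp only [mem_inter, mem_sdiff, mem_compl_type_iff c hcen T₁, not_not]
  have hT''H : T'' ⊆ T₀.1 \ (rt c c T₁).1 := fun x hx => hI ▸ (mem_sdiff.mp hx).1
  have hT''m : T''.card = m := by rw [hT''def, card_sdiff_of_subset hA, hHc, hAm]; omega
  have hB'' : B'' ⊆ T₀.1 \ (T₀.1 \ (rt c c T₁).1) := by
    intro x hx
    have hx' := (mem_sdiff.mp (mem_of_mem_erase hx)).1
    refine mem_sdiff.mpr ⟨(mem_sdiff.mp hx').1, fun h' => ?_⟩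
    rw [← hI] at h'
    exact (mem_sdiff.mp hx').2 (mem_inter.mp h').2
  have hB''m : B''.card < m := by rw [hB''def, card_erase_of_mem hh, card_sdiff_of_subset hTH, hH, hTm]; omega
  have hXc : T₀.1 \ (rt c c (oflipCM c hc2 h Φ)).1 = T'' ∪ B'' := by
    rw [dev_compl c hcen, dev_oflip_of_mem c hc2 hh0 hhΦ, hΦ]
    ext x
    simp only [hT''def, hB''def, mem_sdiff, mem_insert, mem_union, mem_inter, mem_erase, not_or]
    constructor
    · rintro ⟨hx0, hxh, hxT, hxA⟩
      by_cases hx1 : x ∈ T₁.1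
      · exact Or.inl ⟨⟨hx0, hx1⟩, hxA⟩
      · exact Or.inr ⟨hxh, ⟨hx0, hx1⟩, hxT⟩
    · rintro (⟨⟨hx0, hx1⟩, hxA⟩ | ⟨hxh, ⟨hx0, hx1⟩, hxT⟩)
      · refine ⟨hx0, ?_, fun hxT => (mem_sdiff.mp (hTH hxT)).2 hx1, hxA⟩
        rintro rfl; exact hh1 hx1
      · exact ⟨hx0, hxh, hxT, fun hxA => hx1 (mem_inter.mp (hA hxA)).2⟩
  have hS₂'' := strict_triple_orbit_corner c hc2 hcen T₀ (rt c c T₁) hbase₂ m hn hH₂ T'' B'' hT''H hT''m hB'' hB''m (rt c c (oflipCM c hc2 h Φ)) hXc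
    hκ₁ hκ₂ hκ₁₂
  have hS₂' := strict_triple_rt c hc2 T₀ c hS₂''
  rw [← rt_mul, hc2, rt_one, mul_one] at hS₂'
  have hbphc : bpot c T₀ (rt c c (oflipCM c hc2 h Φ)) = 2 * m - 1 := by
    have e := (bpot_orbit_corner c hc2 hcen T₀ (rt c c T₁) hbase₂ m hn hH₂ T'' B'' hT''H hT''m hB'' hB''m (rt c c (oflipCM c hc2 h Φ)) hXc).1
    rw [hB''def, card_erase_of_mem hh, card_sdiff_of_subset hTH, hH, hTm] at e
    rw [e]; omega
  have hbph : bpot c T₀ (oflipCM c hc2 h Φ) = 2 * m - 1 := by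
    have e := bpot_rt c T₀ c (rt c c (oflipCM c hc2 h Φ))
    rw [← rt_mul, hc2, rt_one] at e
    rw [e]; exact hbphc
  obtain ⟨g'', hg''⟩ : ∃ g'' : G, rt c g'' (oflipCM c hc2 h Φ) = (blk c (oflipCM c hc2 h Φ)).out :=
    exists_rt_eq_of_blk_eq c (blk_out c (blk c (oflipCM c hc2 h Φ))).symm
  have hτ₂ := strict_triple_rt c hc2 T₀ g'' hS₂'
  rw [hg''] at hτ₂
  -- the three blocks are distinct
  have h10 : blk c (oflipCM c hc2 a Φ) ≠ blk c Φ := by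
    intro e
    obtain ⟨x, hx⟩ := exists_rt_eq_of_blk_eq c e
    have e2 := bpot_rt c T₀ x (oflipCM c hc2 a Φ)
    rw [hx, hb, hbpa] at e2
    omega
  have h20 : blk c (oflipCM c hc2 h Φ) ≠ blk c Φ := by
    intro e
    obtain ⟨x, hx⟩ := exists_rt_eq_of_blk_eq c e
    have e2 := bpot_rt c T₀ x (oflipCM c hc2 h Φ)
    rw [hx, hb, hbph] at e2
    omega
  have h21 : blk c (oflipCM c hc2 h Φ) ≠ blk c (oflipCM c hc2 a Φ) := by
    intro e
    obtain ⟨x, hx⟩ := exists_rt_eq_of_blk_eq c e.symm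
    exact hB x hx
  -- the admissible choice with the three prescriptions
  obtain ⟨τ, hτ₀, hτB₁, hτB₂, hτlow, hτstr⟩ := exists_admissible_choice₃ c T₀ hc2 (blk c Φ) (blk c (oflipCM c hc2 a Φ))
    (blk c (oflipCM c hc2 h Φ)) (g * Q, a * g⁻¹, (c * h) * g⁻¹) (g' * Q⁻¹, c * h * g'⁻¹, c * h₂ * g'⁻¹)
    (g'' * c, h * g₁⁻¹ * c⁻¹ * g''⁻¹, κ₂ * c⁻¹ * g''⁻¹) h10 h20 h21 hlow₀ h₀ns hτ₁ hτ₂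
  refine isLeast_card_gfaces_generate_of_chosen_cover_closure c T₀ hG hc2 hc1 hcen k τ hτlow hτstr fun S hS hmem hlow => ?_
  -- the lattice of a strict cover containing the chosen faces
  have hP : ∀ Ψ : CMF G c, pair c Ψ ∈ Submodule.span ℤ (pairSet c) ⊔ Submodule.span ℤ (translates c S) :=
    fun Ψ => Submodule.mem_sup_left (Submodule.subset_span (pair_mem_pairSet c Ψ))
  have hLrt : ∀ (Q' : G) (y : CMF G c →₀ ℤ), y ∈ Submodule.span ℤ (pairSet c) ⊔ Submodule.span ℤ (translates c S) →
      Finsupp.mapDomain (rt c Q') y ∈ Submodule.span ℤ (pairSet c) ⊔ Submodule.span ℤ (translates c S) :=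
    fun Q' y hy => mapDomain_rt_mem_psp c hcen Q' S hy
  have hcover : ∀ Ψ : CMF G c, 2 ≤ bpot c T₀ Ψ → ∃ Q₃ x x' : G, bpot c T₀ Ψ = ddist (rt c Q₃ T₀) Ψ ∧
      x ∈ (rt c Q₃ T₀).1 \ Ψ.1 ∧ x' ∈ (rt c Q₃ T₀).1 \ Ψ.1 ∧ x ≠ x' ∧
      gface c hc2 Ψ x x' ∈ Submodule.span ℤ (pairSet c) ⊔ Submodule.span ℤ (translates c S) ∧
      ((∃ Q₁ y y' : G, bpot c T₀ Ψ = ddist (rt c Q₁ T₀) Ψ ∧ y ∈ (rt c Q₁ T₀).1 \ Ψ.1 ∧ y' ∈ (rt c Q₁ T₀).1 \ Ψ.1 ∧ y ≠ y' ∧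
          (∀ Q' : G, ddist (rt c Q' T₀) (oflipCM c hc2 y Ψ) = bpot c T₀ (oflipCM c hc2 y Ψ) → rt c Q' T₀ = rt c Q₁ T₀) ∧
          (∀ Q' : G, ddist (rt c Q' T₀) (oflipCM c hc2 y' Ψ) = bpot c T₀ (oflipCM c hc2 y' Ψ) → rt c Q' T₀ = rt c Q₁ T₀) ∧
          (∀ Q' : G, ddist (rt c Q' T₀) (oflipCM c hc2 y (oflipCM c hc2 y' Ψ)) = bpot c T₀ (oflipCM c hc2 y (oflipCM c hc2 y' Ψ)) →
            rt c Q' T₀ = rt c Q₁ T₀)) →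
        (∀ Q' : G, ddist (rt c Q' T₀) (oflipCM c hc2 x Ψ) = bpot c T₀ (oflipCM c hc2 x Ψ) → rt c Q' T₀ = rt c Q₃ T₀) ∧
        (∀ Q' : G, ddist (rt c Q' T₀) (oflipCM c hc2 x' Ψ) = bpot c T₀ (oflipCM c hc2 x' Ψ) → rt c Q' T₀ = rt c Q₃ T₀) ∧
        (∀ Q' : G, ddist (rt c Q' T₀) (oflipCM c hc2 x (oflipCM c hc2 x' Ψ)) = bpot c T₀ (oflipCM c hc2 x (oflipCM c hc2 x' Ψ)) →
          rt c Q' T₀ = rt c Q₃ T₀)) := by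
    intro Ψ h2
    obtain ⟨Q₃, x, x', hQ₃, hx, hx', hxx', hxmem, hstr⟩ := hlow Ψ h2
    exact ⟨Q₃, x, x', hQ₃, hx, hx', hxx', Submodule.mem_sup_right hxmem, hstr⟩
  -- the three prescribed faces lie in the lattice
  have hback : ∀ (x : G) (X : CMF G c) (s s' : G), gface c hc2 (rt c x X) (s * x⁻¹) (s' * x⁻¹) ∈ S →
      gface c hc2 X s s' ∈ Submodule.span ℤ (pairSet c) ⊔ Submodule.span ℤ (translates c S) := by
    intro x X s s' hS'
    have hS'' : gface c hc2 (rt c x X) (s * x⁻¹) (s' * x⁻¹) ∈ translates c S :=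
      ⟨1, _, hS', by rw [show rt c (1 : G) = id from funext (rt_one c), Finsupp.mapDomain_id]⟩
    have e := hLrt x⁻¹ _ (Submodule.mem_sup_right (Submodule.subset_span hS''))
    rwa [mapDomain_rt_gface, rt_inv_rt, inv_inv, inv_mul_cancel_right, inv_mul_cancel_right] at e
  have hF : gface c hc2 Φ a h ∈ Submodule.span ℤ (pairSet c) ⊔ Submodule.span ℤ (translates c S) := by
    have h2 : 2 ≤ bpot c T₀ (blk c Φ).out := by rw [bpot_out, hb]; omega
    have hS' := hmem (blk c Φ) h2
    rw [hτ₀, ← hg] at hS'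
    have e := hback g Φ a (c * h) hS'
    have e2 : gface c hc2 Φ a (c * h) = gface c hc2 Φ a h := by unfold gface; simp only [oflipCM_cmul]
    rwa [e2] at e
  have hFk : gface c hc2 (oflipCM c hc2 a Φ) h h₂ ∈ Submodule.span ℤ (pairSet c) ⊔ Submodule.span ℤ (translates c S) := by
    have h2 : 2 ≤ bpot c T₀ (blk c (oflipCM c hc2 a Φ)).out := by rw [bpot_out, hbpa]; omega
    have hS' := hmem _ h2
    rw [hτB₁, ← hg'] at hS'
    have e := hback g' _ (c * h) (c * h₂) hS'
    have e2 : gface c hc2 (oflipCM c hc2 a Φ) (c * h) (c * h₂) = gface c hc2 (oflipCM c hc2 a Φ) h h₂ := by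
      unfold gface; simp only [oflipCM_cmul]
    rwa [e2] at e
  have hFh : gface c hc2 (oflipCM c hc2 h Φ) (h * g₁⁻¹) κ₂ ∈ Submodule.span ℤ (pairSet c) ⊔ Submodule.span ℤ (translates c S) := by
    have h2 : 2 ≤ bpot c T₀ (blk c (oflipCM c hc2 h Φ)).out := by rw [bpot_out, hbph]; omega
    have hS' := hmem _ h2
    rw [hτB₂, ← hg''] at hS'
    have e := hback g'' _ (h * g₁⁻¹ * c⁻¹) (κ₂ * c⁻¹) hS'
    have e2 : gface c hc2 (oflipCM c hc2 h Φ) (h * g₁⁻¹ * c⁻¹) (κ₂ * c⁻¹) = gface c hc2 (oflipCM c hc2 h Φ) (h * g₁⁻¹) κ₂ := by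
      rw [hcinv, hcen (h * g₁⁻¹), hcen κ₂]; unfold gface; simp only [oflipCM_cmul]
    rwa [e2] at e
  -- the fibre congruences and the four transversal relations
  obtain ⟨hVT, hVA, hUT, hUA⟩ := fibre_congruences c hc2 hcen T₀ T₁ hbase m hn hH Q hQ _ hLrt hcover hP hQ₁ hσH hm T A hTH hTm hA hAm hT hAtr
    Φ hΦ ha hh hF hh hh₂ hhh₂ hFk hκ₁ hκ₂ hκ₁₂ hFh g₁ hg₀ hg₁ hgΦ hTex hAex
  have hT'tr : ∀ t ∈ T₀.1 \ T₁.1, ∀ t' ∈ T₀.1, (t' = t * Q ∨ t' = c * (t * Q)) → (t ∈ (T₀.1 \ T₁.1) \ T ↔ t' ∉ (T₀.1 \ T₁.1) \ T) := by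
    intro t ht t' ht' hrel
    have h1 := hT t ht t' ht' hrel
    have h2 : t' ∈ T₀.1 \ T₁.1 := (hσH t (mem_sdiff.mp ht).1 t' ht' hrel).mp ht
    simp only [mem_sdiff, not_and, not_not]
    constructor
    · intro h3 _; by_contra h4; exact h3.2 (h1.mpr h4)
    · intro h3; exact ⟨mem_sdiff.mp ht, fun h4 => (h1.mp h4) (h3 (mem_sdiff.mp h2))⟩
  have hA'tr : ∀ t ∈ T₀.1 ∩ T₁.1, ∀ t' ∈ T₀.1, (t' = t * Q ∨ t' = c * (t * Q)) → (t ∈ (T₀.1 ∩ T₁.1) \ A ↔ t' ∉ (T₀.1 ∩ T₁.1) \ A) := by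
    intro t ht t' ht' hrel
    have h1 := hAtr t ht t' ht' hrel
    have htH : t ∉ T₀.1 \ T₁.1 := fun h' => (mem_sdiff.mp h').2 (mem_inter.mp ht).2
    have ht'H : t' ∉ T₀.1 \ T₁.1 := fun h' => htH ((hσH t (mem_inter.mp ht).1 t' ht' hrel).mpr h')
    have h2 : t' ∈ T₀.1 ∩ T₁.1 := mem_inter.mpr ⟨ht', by by_contra h'; exact ht'H (mem_sdiff.mpr ⟨ht', h'⟩)⟩
    simp only [mem_sdiff, not_and, not_not]
    constructor
    · intro h3 _; by_contra h4; exact h3.2 (h1.mpr h4)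
    · intro h3; exact ⟨ht, fun h4 => (h1.mp h4) (h3 h2)⟩
  have hT'cm : ((T₀.1 \ T₁.1) \ T).card = m := by rw [card_sdiff_of_subset hTH, hH, hTm]; omega
  have hA'cm : ((T₀.1 ∩ T₁.1) \ A).card = m := by rw [card_sdiff_of_subset hA, hHc, hAm]; omega
  have hRT := rel_transversal_mem' c hc2 hcen T₀ T₁ hbase m hn hH Q hQ hQ₁ hσH _ hLrt hcover T hTH hTm hT hm
  have hRT' := rel_transversal_mem' c hc2 hcen T₀ T₁ hbase m hn hH Q hQ hQ₁ hσH _ hLrt hcover ((T₀.1 \ T₁.1) \ T) sdiff_subset hT'cm hT'tr hm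
  have hRA := relc_mem' c hc2 hcen T₀ T₁ hbase m hn hH Q hQ hQ₁ hσH _ hLrt hcover A hA hAm hAtr hP hm
  have hRA' := relc_mem' c hc2 hcen T₀ T₁ hbase m hn hH Q hQ hQ₁ hσH _ hLrt hcover ((T₀.1 ∩ T₁.1) \ A) sdiff_subset hA'cm hA'tr hP hm
  have hclose := residual_closure_cyclic c hc2 hc1 hcen T₀ T₁ _ hP k m hkm hH hHc T hTH hTm A hA hAm hRT hRT' hRA hRA' hVT hVA hUT hUA
  -- residual types: `bpot ≤ 1` means a base type or a single flip of one
  intro y hy hyR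
  refine hclose y hy fun Ψ hΨ => ?_
  rcases residual_cases c T₀ hc2 (hyR Ψ hΨ) with ⟨Q', rfl⟩ | ⟨Q', s, -, rfl⟩
  · rcases hbase Q' with h' | h' | h' | h'
    · exact Or.inl h'
    · exact Or.inr (Or.inr (Or.inl h'))
    · exact Or.inr (Or.inl h')
    · exact Or.inr (Or.inr (Or.inr (Or.inl h')))
  · right; right; right; right
    refine ⟨s * Q'⁻¹, ?_⟩
    rw [rt_oflipCM]
    rcases hbase Q' with h' | h' | h' | h' <;> rw [h']
    · exact Or.inl rfl
    · exact Or.inr (Or.inr (Or.inl rfl))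
    · exact Or.inr (Or.inl rfl)
    · exact Or.inr (Or.inr (Or.inr rfl))

end Frame

end

end Summit.HodgeConjecture.CorCM.Census.CentralSquares
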